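import Literature.NumberTheory.Transcendental.KZCalculusProofs
import Literature.NumberTheory.Transcendental.KZProductIdeal
import Literature.NumberTheory.Transcendental.KZDominatedFamilyRelations
import Literature.NumberTheory.Transcendental.KZFibredRelations

/-!
# Route ValuedFieldSpecialisation — crux `CTConstruction`: constant families specialise at class level

Helper toward crux stmt-KontsevichZagierPeriods-3495 (`CTConstruction`), line `registered`, stub
`stub_specialFibreRigidityOfEval` (class-level rigidity of special fibres). The simplest dominated families are
the CONSTANT families `r.cylinder = (0,1) × r` (`KZ.IntegralRep.cylinder`, dominated with special fibre `r`,
`KZ.IntegralRep.isDominatedFamily_cylinder`). For them clause (CT3) of the crux holds ON THE NOSE in the calculus: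
`[r.cylinder] − [r] ∈ KZ.relations` (`of_cylinder_sub_of_mem_relations`: raise the dimension by the Newton–Leibniz
slab `KZ.IntegralRep.slab`, rotate coordinates by the change of variables `KZ.of_sub_of_reindex_mem_relations`
with `finRotate`, and discard the two null faces `{s = 0}`, `{s = 1}` by domain additivity). Consequently the
rigidity stub holds for the subgroup generated by the cylinder pairs `([r.cylinder], [r])` whenever the elementary
part is absent (`specialFibreRigidity_cylinders`; fibred form `stub_specialFibreRigidity_cylinders`, registered sub-goal of the crux): a relation among constant families specialises to a relation
among their fibres. (With a non-zero elementary part this already fails to be provable by such means — see the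
lead report `Cruxes/CTConstruction/LEAD-REPORT-c1.md`, §4(i).)

Sources: M. Kontsevich, D. Zagier, *Periods* (2001), §1.2 (rules (1)–(3)). No new definitions.
-/

noncomputable section

namespace Summit.KontsevichZagierPeriods.ValuedFieldSpecialisation

open MeasureTheory Set Filter
open Literature.NumberTheory.Transcendental Literature.NumberTheory.Transcendental.KZ

variable {n : ℕ}

/-- **Constant families specialise at class level**: `[r.cylinder] − [r] ∈ KZ.relations` — the constant family
`(0,1) × r` (parameter in coordinate `0`) is move-equivalent to its fibre `r`: `r ≡ r.slab 0` (one Newton–Leibniz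
move, `KZ.IntegralRep.equivalent_slab`), `r.slab 0 ≡ (r.slab 0).reindex (finRotate (n + 1))` (coordinate
rotation, `KZ.of_sub_of_reindex_mem_relations`), and the rotated slab is the closed cylinder `[0,1] × r`, which
differs from `r.cylinder` by the null faces `{s = 0} ∪ {s = 1}` (domain additivity,
`KZ.IntegralRep.of_sub_of_restrict_mem_relations`). [Kontsevich–Zagier 2001, §1.2 rules (1)–(3)] [folklore] -/
theorem of_cylinder_sub_of_mem_relations (r : IntegralRep n) : of r.cylinder - of r ∈ relations := by
  set e : Fin (n + 1) ≃ Fin (n + 1) := finRotate (n + 1) with he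
  set A : IntegralRep (n + 1) := (r.slab 0).reindex e with hA
  have he0 : ∀ w : Fin (n + 1) → ℝ, (fun i => w (e i)) (Fin.last n) = w 0 := by
    intro w
    simp [he]
  have heinit : ∀ w : Fin (n + 1) → ℝ, Fin.init (fun i => w (e i)) = fun i : Fin n => w i.succ := by
    intro w
    ext i
    simp [Fin.init, he, Fin.coeSucc_eq_succ]
  have hAdom : A.domain = {w | (fun i : Fin n => w i.succ) ∈ r.domain ∧ (0 : ℝ) ≤ w 0 ∧ w 0 ≤ 1} := by
    ext w
    simp only [hA, IntegralRep.reindex_domain, IntegralRep.domain_slab, IntegralRep.slabDomain, mem_setOf_eq,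
      heinit, he0, Nat.cast_zero, zero_add]
  have hAint : ∀ w, A.integrand w = r.integrand (fun i : Fin n => w i.succ) := by
    intro w
    simp only [hA, IntegralRep.reindex_integrand, IntegralRep.integrand_slab, heinit]
  have hsub : r.cylinderDomain ⊆ A.domain := by
    intro w hw
    rw [hAdom]
    exact ⟨hw.2.2, hw.1.le, hw.2.1.le⟩
  have hnull : volume (A.domain \ r.cylinderDomain) = 0 := by
    -- the two faces `{w 0 = 0}`, `{w 0 = 1}` are null hyperplanes (`Measure.pi_hyperplane`)
    have hface : ∀ c : ℝ, volume {w : Fin (n + 1) → ℝ | w 0 = c} = 0 := fun c => by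
      simpa [volume_pi] using Measure.pi_hyperplane (fun _ : Fin (n + 1) => (volume : Measure ℝ)) 0 c
    refine measure_mono_null (fun w hw => ?_) (measure_union_null (hface 0) (hface 1))
    obtain ⟨hwA, hwc⟩ := hw
    rw [hAdom] at hwA
    obtain ⟨hx, h0, h1⟩ := hwA
    simp only [mem_union, mem_setOf_eq]
    by_contra hcon
    push Not at hcon
    exact hwc ⟨lt_of_le_of_ne h0 (Ne.symm hcon.1), lt_of_le_of_ne h1 hcon.2, hx⟩
  have h1 : of A - of (A.restrict r.cylinderDomain r.isSemialgebraic_cylinderDomain hsub) ∈ relations :=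
    A.of_sub_of_restrict_mem_relations r.isSemialgebraic_cylinderDomain hsub hnull
  have h2 : of (A.restrict r.cylinderDomain r.isSemialgebraic_cylinderDomain hsub) - of r.cylinder ∈ relations :=
    of_sub_of_mem_relations_of_eqOn rfl fun w _ => by
      rw [IntegralRep.integrand_restrict, hAint, IntegralRep.integrand_cylinder]
  have h3 : of (r.slab 0) - of A ∈ relations := of_sub_of_reindex_mem_relations _ e
  have h4 : of r - of (r.slab 0) ∈ relations := r.equivalent_slab 0
  have : of r.cylinder - of r = -((of r - of (r.slab 0)) + (of (r.slab 0) - of A) +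
      (of A - of (A.restrict r.cylinderDomain r.isSemialgebraic_cylinderDomain hsub)) +
      (of (A.restrict r.cylinderDomain r.isSemialgebraic_cylinderDomain hsub) - of r.cylinder)) := by
    abel
  rw [this]
  exact relations.neg_mem (relations.add_mem (relations.add_mem (relations.add_mem h4 h3) h1) h2)

/-- In the subgroup of `FormalRep × FormalRep` generated by the cylinder pairs `([r.cylinder], [r])`, the two
components are congruent modulo `KZ.relations`. [Kontsevich–Zagier 2001, §1.2] [folklore] -/
theorem fst_sub_snd_mem_relations_of_mem_closure_cylinderPairs {v : FormalRep × FormalRep}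
    (hv : v ∈ AddSubgroup.closure {v : FormalRep × FormalRep | ∃ (n : ℕ) (r : IntegralRep n),
      v = (of r.cylinder, of r)}) :
    v.1 - v.2 ∈ relations := by
  induction hv using AddSubgroup.closure_induction with
  | mem w hw =>
    obtain ⟨n, r, rfl⟩ := hw
    exact of_cylinder_sub_of_mem_relations r
  | zero => simp [relations.zero_mem]
  | add w w' _ _ ih ih' =>
    have : (w + w').1 - (w + w').2 = (w.1 - w.2) + (w'.1 - w'.2) := by
      simp only [Prod.fst_add, Prod.snd_add]; abel
    rw [this]
    exact relations.add_mem ih ih'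
  | neg w _ ih =>
    have : (-w).1 - (-w).2 = -(w.1 - w.2) := by
      simp only [Prod.fst_neg, Prod.snd_neg]; abel
    rw [this]
    exact relations.neg_mem ih

/-- **Special-fibre rigidity for constant families** (the cylinder instances of stub
`stub_specialFibreRigidityOfEval` of crux `CTConstruction`, with no elementary part): if `(G, y)` lies in the
subgroup generated by the cylinder pairs `([r.cylinder], [r])` and `G` is a relation (e.g. a fibred relation),
then `y ∈ KZ.relations`. No hypothesis on `eval y` is needed. [Kontsevich–Zagier 2001, §1.2] [folklore] -/
theorem specialFibreRigidity_cylinders {G y : FormalRep}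
    (hGy : (G, y) ∈ AddSubgroup.closure {v : FormalRep × FormalRep | ∃ (n : ℕ) (r : IntegralRep n),
      v = (of r.cylinder, of r)})
    (hG : G ∈ relations) : y ∈ relations := by
  have h := fst_sub_snd_mem_relations_of_mem_closure_cylinderPairs hGy
  have : y = G - (G - y) := by abel
  rw [this]
  exact relations.sub_mem hG h

/-- The same with a FIBRED relation `G` (`KZ.fibredRelations ≤ KZ.relations`): the case `D = 0`,
"`G` generated by constant families" of the rigidity stub. [Kontsevich–Zagier 2001, §1.2] [folklore] -/
theorem stub_specialFibreRigidity_cylinders : ∀ (G y : Literature.NumberTheory.Transcendental.KZ.FormalRep), (G, y) ∈ AddSubgroup.closure {v : Literature.NumberTheory.Transcendental.KZ.FormalRep × Literature.NumberTheory.Transcendental.KZ.FormalRep | ∃ (n : ℕ) (r : Literature.NumberTheory.Transcendental.KZ.IntegralRep n), v = (Literature.NumberTheory.Transcendental.KZ.of r.cylinder, Literature.NumberTheory.Transcendental.KZ.of r)} → G ∈ Literature.NumberTheory.Transcendental.KZ.fibredRelations → y ∈ Literature.NumberTheory.Transcendental.KZ.relations :=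
  fun _ _ hGy hG =>
  specialFibreRigidity_cylinders hGy (fibredRelations_le_relations hG)

end Summit.KontsevichZagierPeriods.ValuedFieldSpecialisation
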